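import Literature.NumberTheory.EllipticCurves.RationalIsogenyFrobeniusCriterion
import Literature.NumberTheory.EllipticCurves.RationalIsogenyFrobeniusCertificatesCM
import HarnessLib

/-!
# Crux `MazurKenkuBound` (stmt-ABC-15125), line `Sketch` — stub `stub_certCM`:
# no rational `7`- or `13`-isogeny out of the `j`-tables of `X₀(43)`, `X₀(67)`, `X₀(163)`

Kenku 1982, proof of Thm. 1, case (c), at the levels `7N` and `13N` for `N ∈ {43, 67, 163}`: a
cyclic `ℚ`-isogeny of degree `7N` or `13N` would give, out of one elliptic curve over `ℚ`, a
rational `N`-isogeny — so `j` is the CM value of the table of `X₀(N)`: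
`43 ↦ -960³ = -884736000`, `67 ↦ -5280³ = -147197952000`, `163 ↦ -640320³ = -262537412640768000`
— and a rational `7`- resp. `13`-isogeny. The latter is refuted, `j` by `j`, by a Frobenius
certificate (Mazur 1978, Prop. 6.3 (1)): for the globally minimal integer model `E₀` with that `j`
and a good prime `ℓ`, `X² − a_ℓX + ℓ` must have a root modulo the isogeny degree `q`, and it has
none modulo `7` and `13`.

All the arithmetic is in the landed criterion
`Literature.NumberTheory.EllipticCurves.j_ne_of_isogeny_prime_degree_of_certificate'`
(`RationalIsogenyFrobeniusCriterion.lean`) and the kernel-decided point counts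
`KenkuLevelsCert.card_E43_*`, `card_E67_*`, `card_E163_*`
(`RationalIsogenyFrobeniusCertificatesCM.lean`); this file only feeds them the three rows of data:

* `j = -884736000`: `E₀ = [0, 0, 1, -860, 9707]`, `Δ = -43³`, `ℓ = 2`, `#Ẽ₀(𝔽₂) = 3` (`a₂ = 0`);
* `j = -147197952000`: `E₀ = [0, 0, 1, -7370, 243528]`, `Δ = -67³`, `ℓ = 2`, `#Ẽ₀(𝔽₂) = 3`
  (`a₂ = 0`);
* `j = -262537412640768000`: `E₀ = [0, 0, 1, -2174420, 1234136692]`, `Δ = -163³`, `ℓ = 2`,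
  `#Ẽ₀(𝔽₂) = 3` (`a₂ = 0`).

`X² + 2` is root-free modulo `7` and modulo `13` (`decide`).

## References

* [Mazur1978] B. Mazur, *Rational isogenies of prime degree*, Invent. Math. 44 (1978) 129–162,
  §6 Prop. 6.3 (1) (p. 153), Thm. 1 and the table p. 129 (`X₀(43)`, `X₀(67)`, `X₀(163)`).
* [Kenku1982] M. A. Kenku, *On the number of ℚ-isomorphism classes of elliptic curves in each
  ℚ-isogeny class*, J. Number Theory 15 (1982) 199–202, proof of Thm. 1, case (c), p. 201.
-/

-- `Summit.ABC.ABC` is the mandated summit-side namespace (CONVENTIONS §2); the duplicate is deliberate.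
set_option linter.dupNamespace false

noncomputable section

open scoped Classical
open WeierstrassCurve
open Literature.NumberTheory.EllipticCurves

namespace Summit.ABC.ABC.Theorems

/-- No `ℚ`-isogeny of degree `7` or `13` out of an elliptic curve over `ℚ` with
`j = -884736000 = -960³` (CM by `-43`; model `[0, 0, 1, -860, 9707]`, `Δ = -43³`, witness prime
`ℓ = 2`, `a₂ = 0`: `X² + 2` has no root modulo `7` or `13`).
[cite: Mazur1978, §6 Prop. 6.3 (1) (p. 153)]
[cite: Kenku1982, proof of Thm. 1, case (c), p. 201] -/
private theorem j_ne_jm884736000 {W W' : WeierstrassCurve ℚ} [W.IsElliptic] [W'.IsElliptic]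
    (ψ : Isogeny W W') (hq : ψ.degree = 7 ∨ ψ.degree = 13) : W.j ≠ -884736000 := by
  have hj : (((⟨0, 0, 1, -860, 9707⟩ : WeierstrassCurve ℤ)).c₄ : ℚ) ^ 3 /
      (((⟨0, 0, 1, -860, 9707⟩ : WeierstrassCurve ℤ)).Δ : ℚ) = -884736000 := by
    norm_num [WeierstrassCurve.Δ, WeierstrassCurve.c₄, WeierstrassCurve.b₂, WeierstrassCurve.b₄,
      WeierstrassCurve.b₆, WeierstrassCurve.b₈]
  -- the two root-freeness certificates, decided BEFORE any local `Fact` instance is introduced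
  -- (a local `Fact (Nat.Prime q)` would be picked up by `Fintype (ZMod q)` and block `decide`)
  have hnr7 : ∀ t : ZMod 7,
      t ^ 2 - (((2 : ℕ) : ℤ) + 1 - (3 : ℕ) : ℤ) * t + ((2 : ℕ) : ZMod 7) ≠ 0 := by
    decide +kernel
  have hnr13 : ∀ t : ZMod 13,
      t ^ 2 - (((2 : ℕ) : ℤ) + 1 - (3 : ℕ) : ℤ) * t + ((2 : ℕ) : ZMod 13) ≠ 0 := by
    decide +kernel
  rw [← hj]
  haveI : Fact (Nat.Prime 2) := ⟨by norm_num⟩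
  rcases hq with hq | hq
  · haveI : Fact (Nat.Prime 7) := ⟨by norm_num⟩
    exact j_ne_of_isogeny_prime_degree_of_certificate' _ (B := 3) (by decide +kernel)
      (by decide +kernel) (by decide +kernel) (by decide +kernel) (ℓ := 2) (by decide +kernel)
      KenkuLevelsCert.card_E43_jm884736000_2 (q := 7) (by norm_num) hnr7 ψ hq
  · haveI : Fact (Nat.Prime 13) := ⟨by norm_num⟩
    exact j_ne_of_isogeny_prime_degree_of_certificate' _ (B := 3) (by decide +kernel)
      (by decide +kernel) (by decide +kernel) (by decide +kernel) (ℓ := 2) (by decide +kernel)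
      KenkuLevelsCert.card_E43_jm884736000_2 (q := 13) (by norm_num) hnr13 ψ hq

/-- No `ℚ`-isogeny of degree `7` or `13` out of an elliptic curve over `ℚ` with
`j = -147197952000 = -5280³` (CM by `-67`; model `[0, 0, 1, -7370, 243528]`, `Δ = -67³`, witness
prime `ℓ = 2`, `a₂ = 0`: `X² + 2` has no root modulo `7` or `13`).
[cite: Mazur1978, §6 Prop. 6.3 (1) (p. 153)]
[cite: Kenku1982, proof of Thm. 1, case (c), p. 201] -/
private theorem j_ne_jm147197952000 {W W' : WeierstrassCurve ℚ} [W.IsElliptic] [W'.IsElliptic]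
    (ψ : Isogeny W W') (hq : ψ.degree = 7 ∨ ψ.degree = 13) : W.j ≠ -147197952000 := by
  have hj : (((⟨0, 0, 1, -7370, 243528⟩ : WeierstrassCurve ℤ)).c₄ : ℚ) ^ 3 /
      (((⟨0, 0, 1, -7370, 243528⟩ : WeierstrassCurve ℤ)).Δ : ℚ) = -147197952000 := by
    norm_num [WeierstrassCurve.Δ, WeierstrassCurve.c₄, WeierstrassCurve.b₂, WeierstrassCurve.b₄,
      WeierstrassCurve.b₆, WeierstrassCurve.b₈]
  have hnr7 : ∀ t : ZMod 7,
      t ^ 2 - (((2 : ℕ) : ℤ) + 1 - (3 : ℕ) : ℤ) * t + ((2 : ℕ) : ZMod 7) ≠ 0 := by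
    decide +kernel
  have hnr13 : ∀ t : ZMod 13,
      t ^ 2 - (((2 : ℕ) : ℤ) + 1 - (3 : ℕ) : ℤ) * t + ((2 : ℕ) : ZMod 13) ≠ 0 := by
    decide +kernel
  rw [← hj]
  haveI : Fact (Nat.Prime 2) := ⟨by norm_num⟩
  rcases hq with hq | hq
  · haveI : Fact (Nat.Prime 7) := ⟨by norm_num⟩
    exact j_ne_of_isogeny_prime_degree_of_certificate' _ (B := 3) (by decide +kernel)
      (by decide +kernel) (by decide +kernel) (by decide +kernel) (ℓ := 2) (by decide +kernel)
      KenkuLevelsCert.card_E67_jm147197952000_2 (q := 7) (by norm_num) hnr7 ψ hq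
  · haveI : Fact (Nat.Prime 13) := ⟨by norm_num⟩
    exact j_ne_of_isogeny_prime_degree_of_certificate' _ (B := 3) (by decide +kernel)
      (by decide +kernel) (by decide +kernel) (by decide +kernel) (ℓ := 2) (by decide +kernel)
      KenkuLevelsCert.card_E67_jm147197952000_2 (q := 13) (by norm_num) hnr13 ψ hq

/-- No `ℚ`-isogeny of degree `7` or `13` out of an elliptic curve over `ℚ` with
`j = -262537412640768000 = -640320³` (CM by `-163`; model `[0, 0, 1, -2174420, 1234136692]`,
`Δ = -163³`, witness prime `ℓ = 2`, `a₂ = 0`: `X² + 2` has no root modulo `7` or `13`).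
[cite: Mazur1978, §6 Prop. 6.3 (1) (p. 153)]
[cite: Kenku1982, proof of Thm. 1, case (c), p. 201] -/
private theorem j_ne_jm262537412640768000 {W W' : WeierstrassCurve ℚ} [W.IsElliptic]
    [W'.IsElliptic] (ψ : Isogeny W W') (hq : ψ.degree = 7 ∨ ψ.degree = 13) :
    W.j ≠ -262537412640768000 := by
  have hj : (((⟨0, 0, 1, -2174420, 1234136692⟩ : WeierstrassCurve ℤ)).c₄ : ℚ) ^ 3 /
      (((⟨0, 0, 1, -2174420, 1234136692⟩ : WeierstrassCurve ℤ)).Δ : ℚ) =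
        -262537412640768000 := by
    norm_num [WeierstrassCurve.Δ, WeierstrassCurve.c₄, WeierstrassCurve.b₂, WeierstrassCurve.b₄,
      WeierstrassCurve.b₆, WeierstrassCurve.b₈]
  have hnr7 : ∀ t : ZMod 7,
      t ^ 2 - (((2 : ℕ) : ℤ) + 1 - (3 : ℕ) : ℤ) * t + ((2 : ℕ) : ZMod 7) ≠ 0 := by
    decide +kernel
  have hnr13 : ∀ t : ZMod 13,
      t ^ 2 - (((2 : ℕ) : ℤ) + 1 - (3 : ℕ) : ℤ) * t + ((2 : ℕ) : ZMod 13) ≠ 0 := by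
    decide +kernel
  rw [← hj]
  haveI : Fact (Nat.Prime 2) := ⟨by norm_num⟩
  rcases hq with hq | hq
  · haveI : Fact (Nat.Prime 7) := ⟨by norm_num⟩
    exact j_ne_of_isogeny_prime_degree_of_certificate' _ (B := 4) (by decide +kernel)
      (by decide +kernel) (by decide +kernel) (by decide +kernel) (ℓ := 2) (by decide +kernel)
      KenkuLevelsCert.card_E163_jm262537412640768000_2 (q := 7) (by norm_num) hnr7 ψ hq
  · haveI : Fact (Nat.Prime 13) := ⟨by norm_num⟩
    exact j_ne_of_isogeny_prime_degree_of_certificate' _ (B := 4) (by decide +kernel)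
      (by decide +kernel) (by decide +kernel) (by decide +kernel) (ℓ := 2) (by decide +kernel)
      KenkuLevelsCert.card_E163_jm262537412640768000_2 (q := 13) (by norm_num) hnr13 ψ hq

/-- **Kenku 1982, case (c), levels `7N` and `13N` for `N ∈ {43, 67, 163}`, per `j`.** No elliptic
curve over `ℚ` whose `j`-invariant is one of the CM values of the tables of `X₀(43)`, `X₀(67)`,
`X₀(163)`, `j ∈ {-960³, -5280³, -640320³} = {-884736000, -147197952000, -262537412640768000}`,
admits a `ℚ`-isogeny of degree `7` or `13`: by Mazur 1978, Prop. 6.3 (1), such an isogeny out of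
the globally minimal models `[0,0,1,-860,9707]`, `[0,0,1,-7370,243528]`,
`[0,0,1,-2174420,1234136692]` would force a root of `X² − a₂X + 2 = X² + 2` modulo `7` resp. `13`
at the good prime `ℓ = 2` (`a₂ = 0` in all three cases), and there is none.
[cite: Mazur1978, §6 Prop. 6.3 (1) (p. 153)]
[cite: Kenku1982, proof of Thm. 1, case (c), p. 201] -/
theorem stub_certCM :
    ∀ (W W' : WeierstrassCurve ℚ) [W.IsElliptic] [W'.IsElliptic] (ψ : Isogeny W W'),
      (ψ.degree = 7 ∨ ψ.degree = 13) →
        W.j ∉ ({-884736000, -147197952000, -262537412640768000} : Finset ℚ) := by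
  intro W W' _ _ ψ hq hmem
  simp only [Finset.mem_insert, Finset.mem_singleton] at hmem
  rcases hmem with h | h | h
  · exact j_ne_jm884736000 ψ hq h
  · exact j_ne_jm147197952000 ψ hq h
  · exact j_ne_jm262537412640768000 ψ hq h

end Summit.ABC.ABC.Theorems

end
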